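import Literature.NumberTheory.EllipticCurves.HeegnerPointsKolyvaginStructure
import HarnessLib

/-!
# W. Zhang 2014, §1: the non-vanishing `κ^∞ ≠ {0}` of the Heegner-point Kolyvagin system
# (Thm. 1.1 = Thm. 9.3; posed by Kolyvagin in 1991, a THEOREM of the source) and
# `ord κ^∞ = max{r_p^+, r_p^-} − 1` (Thm. 1.2), in the case `N⁻ = 1`

Source (read 2026-08-27 on the held publisher text `paper:doi-10-4310-cjm-2014-v2-n2-a2`,
printed page = file page): W. Zhang, *Selmer groups and the indivisibility of Heegner points*,
Camb. J. Math. **2** (2014) 191–253 [`WZhang2014`]. One file for the paper's §1 "Introduction and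
main results" items that were not yet in the tree BY NAME (cell `bsd-print-x9`, typer seat ty1,
D-0064): Theorem 1.1 as a statement-only named fact, Theorem 1.2 as a THEOREM composed from
Theorem 1.1 and the tree's transcription of Kolyvagin's structure theorem
(`Kolyvagin1991_selmerCorank_of_kolyvaginClass_ne_zero`, which already cites Zhang's Thm. 11.2 (i)).
Already in the tree and NOT restated here: Thm. 1.4 (i) (`WZhang2014.thm14i_rank_one_of_selmerCorank_eq_one`),
Thm. 1.6 (`WZhang2014_padicValRat_bsd_rank_one_ordinary`, file `LeadingTermPPartRankLeOne`),
Thm. 6.4 (`WZhang2014.thm64_padicValNat_congruenceNumber_eq`), the objects of §3.7 / "Notations"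
(xii) (`KolyvaginHeegnerData`, `KolyvaginHeegnerData.kolyvaginClass` = `c_M(n)`,
`Zhang2014.kolyvaginIndex` = `M(ℓ)`, `Zhang2014.IsKolyvaginPrime`, `Zhang2014.levelIndex` = `M(n)`,
`KolyvaginDescent.KolSupp` = `n ∈ Λ`; file `HeegnerPointsOfConductor`), and the multiplicative
sibling Skinner–Zhang 2014 Thm. 1.3 (`SkinnerZhang2014.thm1_3_exists_kolyvaginClass_one_ne_zero_OPEN`,
whose statement shape is reused here).

## The printed statements (verbatim)

* Standing, p. 193: *"Throughout this paper we assume that `ρ̄_{E,p}` is surjective, `p ∤ N`, and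
  `p ≥ 5`."*
* p. 194: *"let `K = ℚ[√−D]` be an imaginary quadratic field of discriminant `D_K = −D < 0` with
  `(D, N) = 1`. Write `N = N⁺N⁻` where the prime factors of `N⁺` (`N⁻`, resp.) are all split
  (inert, resp.) in `K`. Assume that `N⁻` is square-free … We fix a prime `p` with surjective
  `ρ̄_{E,p}`. We call a prime `ℓ` a Kolyvagin prime if `ℓ` is prime to `NDp`, inert in `K` and the
  Kolyvagin index `M(ℓ) := min{v_p(ℓ+1), v_p(a_ℓ)}` is strictly positive. Let `Λ` be the set of
  square-free product of distinct Kolyvagin primes. Define `M(n) = min{M(ℓ) : ℓ ∣ n}` if `n > 1`,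
  and `M(1) = ∞`. To each `y(n)` and `M ≤ M(n)`, Kolyvagin associated a cohomology class
  `c_M(n) ∈ H¹(K, E[p^M])` (cf. §3 (3.21) for the precise definition). Denote
  `κ^∞ = {c_M(n) ∈ H¹(K, E[p^M]) : n ∈ Λ, M ≤ M(n)}`. … Let `Ram(ρ̄_{E,p})` be the set of primes
  `ℓ ∥ N` such that `ρ̄_{E,p}` is ramified at `ℓ`. We further impose the following ramification
  assumption on `ρ̄_{E,p}` (depending on the decomposition `N = N⁺N⁻`, hence on `K`), called
  Hypothesis ♠ for `(E, p, K)`:"* (p. 195) *"(1) `Ram(ρ̄_{E,p})` contains all primes `ℓ` such that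
  `ℓ ∥ N⁺` and all primes `ℓ ∣ N⁻` such that `ℓ ≡ ±1 mod p`. (2) If `N` is not square-free, then
  `#Ram(ρ̄_{E,p}) ≥ 1`, and either `Ram(ρ̄_{E,p})` contains a prime `ℓ ∥ N⁻` or there are at least
  two primes factors `ℓ ∥ N⁺`."*
* **Theorem 1.1** (p. 195; = Thm. 9.3, p. 243, whose proof "follows trivially from Theorem 9.1"):
  *"Let `E/ℚ` be an elliptic curve of conductor `N`, `p` a prime and `K` an imaginary quadratic
  field, such that • `N⁻` is square-free with even number of prime factors. • The residue
  representation `ρ̄_{E,p}` is surjective. • Hypothesis ♠ holds for `(E, p, K)`. • The prime `p ≥ 5`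
  is ordinary, `p ∤ D_K N` and `(D_K, N) = 1`. Then we have `c_1(n) ≠ 0` for some `n ∈ Λ`, and
  hence `κ^∞ ≠ {0}`."*
* **Theorem 1.2** (p. 195): *"Let `(E, p, K)` be as in Theorem 1.1. Then we have
  (1.1) `ord κ^∞ = max{r_p^+(E/K), r_p^-(E/K)} − 1`. Furthermore, we denote `ν_∞ = ord κ^∞` and
  `ε_{ν_∞} := ε · (−1)^{ν_∞+1} ∈ {±1}`, where `ε = ε(E/ℚ)` is the global root number of `E/ℚ`. Then
  we have `r_p^{ε_{ν_∞}}(E/K) = ν_∞ + 1`, and `0 ≤ ν_∞ − r_p^{−ε_{ν_∞}}(E/K) ≡ 0 mod 2`."*, where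
  (p. 195) *"The vanishing order `ord κ^∞` of the Kolyvagin system `κ^∞` is, by definition, the
  minimal number of prime factors of `n ∈ Λ` such that `c_M(n) ≠ 0` for some `M ≤ M(n)`. Let
  `Sel^±_{p^∞}(E/K)` denote the eigenspace with eigenvalue `±1` of `Sel_{p^∞}(E/K)` under the
  complex conjugation. Let `r_p^±(E/K)` be the `ℤ_p`-corank of `Sel^±_{p^∞}(E/K)`. Combining
  Theorem 1.1 with Kolyvagin's theorem [24, Theorem 4], we have …"* (proof: Thm. 11.2, p. 248).

## Transcription (the case `N⁻ = 1`, i.e. every prime factor of `N` splits in `K`)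

* `W` a globally minimal Weierstrass model of `E/ℚ` (`a_ℓ = W.frobeniusTrace ℓ`,
  `N = W.conductorNorm ℤ`, `Δ_min = W.minimalDiscriminantInt`), `p ≥ 5` (`h5`) of GOOD
  (`hgood`, "`p ∤ N`") ORDINARY (`hord : p ∤ a_p`) reduction with `ρ̄_{E,p}` surjective (`hsurj`);
  `K` imaginary quadratic (`IsImaginaryQuadratic`), `p ∤ D_K` (`hpD`), `(D_K, N) = 1` (`hDN`), and
  the Heegner hypothesis `SatisfiesHeegnerHypothesis N K` (every `ℓ ∣ N` splits in `K`), which is the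
  first bullet with `N⁻ = 1`, `N⁺ = N` (zero prime factors, an even number).
* "`ℓ ∥ N`" = multiplicative reduction at `ℓ` (`W.HasMultiplicativeReductionAtPrime ℓ`); for such
  `ℓ` (`≠ p`, `p` being good) "`ρ̄_{E,p}` is ramified at `ℓ`" ⟺ `p ∤ v_ℓ(Δ_min)` (Tate's
  parametrisation), spelled `¬ p ∣ padicValInt ℓ W.minimalDiscriminantInt` EXACTLY as in the tree's
  Zhang Thm. 1.4/1.6 records (`WZhang2014_padicValRat_bsd_rank_one_ordinary`, binders `h2`, `h3`)
  and Skinner–Zhang Thm. 1.3. Hypothesis ♠ at `N⁻ = 1`: (1) = `hS1` (every multiplicative prime is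
  in `Ram`; the `N⁻`-clause is void); (2) = `hS2`: if `N` is not square-free
  (`¬ Squarefree (W.conductorNorm ℤ)`) then `Ram ≠ ∅` and (the `ℓ ∥ N⁻` alternative being void)
  there are two distinct multiplicative primes.
* Conclusion: as in the tree's records of Skinner–Zhang Thm. 1.3 and Burungale–Castella–Grossi–
  Skinner 2026 Thm. 1 (file `HeegnerPointsKolyvaginStructure`): THERE EXIST a modular
  parametrisation datum `Dt` of level `N`, an orientation `β`, an embedding `ι : K → ℂ`, a
  square-free product `n` of Kolyvagin primes (`KolyvaginDescent.KolSupp (Zhang2014.IsKolyvaginPrime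
  N W K p) n`, i.e. `n ∈ Λ`), a Kolyvagin–Heegner datum `d` of conductor `n` (the point
  `y(n) ∈ E(K[n])`, CM theory) with `1 ≤ M(n)` and `c_1(n) = d.kolyvaginClass _ 1 ≠ 0` in
  `H¹(K, E[p])`.
* Faithfulness. WEAKER than print, never stronger: (i) only `N⁻ = 1` (modular curve `X₀(N)`; the
  tree's `KolyvaginHeegnerData` is the `X₀(N)` construction) —
  `-- TODO(general form): N⁻ square-free with an even number of prime factors (Shimura curves X_{N⁺,N⁻}).`
  (ii) the parametrisation is quantified existentially, whereas print proves `c_1(n) ≠ 0` for the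
  classes built from the `(𝒪, p)`-optimal parametrisation (3.20) (p. 211: "the image of
  `T_p(J(X)) → T_p(A)` is not contained in `pT_p(A)`"); for any curve `W` of the `ℚ`-isogeny class
  the printed statement yields ours, every isogeny in the class having degree prime to `p` under
  (sur) and inducing `E₀[p] ≅ W[p]`, Heegner points to Heegner points (the same reading as the two
  sibling records; modularity and CM rationality of `y(n)` are the printed inputs behind `Dt`, `d`).
  (iii) `(D_K, N) = 1` is kept as a binder although it follows from the Heegner hypothesis.
* Theorem 1.2 is NOT a new fact: `thm12_max_selmerCorank_eq_ord_add_one` derives it from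
  `thm11_exists_kolyvaginClass_one_ne_zero` and `Kolyvagin1991_selmerCorank_of_kolyvaginClass_ne_zero`
  exactly as printed ("Combining Theorem 1.1 with Kolyvagin's theorem [24, Theorem 4]"), with
  Kolyvagin's standing `D_K ≠ −3, −4` as explicit binders, `ord κ^∞` realised as the number of
  prime factors `ν(n)` of a non-zero class of minimal `ν` (obtained by `Nat.find`), and
  `r_p^+ = corank Sel_{p^∞}(E/ℚ)`, `r_p^- = corank Sel_{p^∞}(E^{D_K}/ℚ)` (`WeierstrassCurve.selmerCorank`
  of `W` and of `W.quadraticTwist D_K`), the currency of the Kolyvagin record; which sign carries the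
  larger corank (the `ε_{ν_∞}` clause) is forgotten there and hence here.

Status on the cell's leaves (for the record, not used): DEAD on class X9/X10b (hypothesis (sur);
`p ≥ 5`). Nothing is asserted: users take `(h : thm11_exists_kolyvaginClass_one_ne_zero)`; no
`_holds` is expected (size XL: level raising, Jacquet–Langlands, the BDP/Gross formula mod `p`,
Kato–Skinner–Urban in rank `0`).

## References
* [WZhang2014] pp. 193–199 (standing hypotheses, Notations, Hypothesis ♠, Thms. 1.1–1.2), §3.7
  (3.20)–(3.22) (pp. 211–212), Thm. 9.3 (p. 243), Thm. 11.2 (p. 248).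
* [Kolyvagin1991MathAnn] V. A. Kolyvagin, Math. Ann. 291 (1991), Thm. 4 — tree record
  `Kolyvagin1991_selmerCorank_of_kolyvaginClass_ne_zero`.
* [GrossLMS1991] §§3–4 — the objects `y(n)`, `P(n)`, `c(n)` (file `HeegnerPointsOfConductor`).
-/

noncomputable section

open scoped Classical

open WeierstrassCurve Literature.NumberTheory.EllipticCurves.ModularForms

namespace Literature.NumberTheory.EllipticCurves.WZhang2014

/-- **W. Zhang 2014, Theorem 1.1 (= Theorem 9.3) — the Heegner-point Kolyvagin system does not
vanish, `κ^∞ ≠ {0}` (the non-vanishing posed by Kolyvagin in 1991; a THEOREM of the source), case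
`N⁻ = 1`.** Verbatim (Camb. J. Math. 2 (2014), p. 195): *"Let `E/ℚ` be an elliptic curve of
conductor `N`, `p` a prime and `K` an imaginary quadratic field, such that • `N⁻` is square-free
with even number of prime factors. • The residue representation `ρ̄_{E,p}` is surjective.
• Hypothesis ♠ holds for `(E, p, K)`. • The prime `p ≥ 5` is ordinary, `p ∤ D_K N` and
`(D_K, N) = 1`. Then we have `c_1(n) ≠ 0` for some `n ∈ Λ`, and hence `κ^∞ ≠ {0}`."*, with
Hypothesis ♠ (p. 195): *"(1) `Ram(ρ̄_{E,p})` contains all primes `ℓ` such that `ℓ ∥ N⁺` and all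
primes `ℓ ∣ N⁻` such that `ℓ ≡ ±1 mod p`. (2) If `N` is not square-free, then `#Ram(ρ̄_{E,p}) ≥ 1`,
and either `Ram(ρ̄_{E,p})` contains a prime `ℓ ∥ N⁻` or there are at least two primes factors
`ℓ ∥ N⁺`"*, `Ram(ρ̄_{E,p})` = the primes `ℓ ∥ N` at which `ρ̄_{E,p}` is ramified (p. 194).
Transcription at `N⁻ = 1` (module docstring): `W` globally minimal, `5 ≤ p`, good ordinary at `p`
(`p ∤ N`, `p ∤ a_p`), `ρ̄_{E,p}` surjective; ♠(1) `hS1`: every prime `ℓ` of multiplicative reduction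
has `p ∤ v_ℓ(Δ_min)` (`ρ̄` ramified at `ℓ`, Tate); ♠(2) `hS2`: if `N` is not square-free, some
multiplicative `ℓ` has `p ∤ v_ℓ(Δ_min)` and there are two distinct multiplicative primes; `K`
imaginary quadratic with every `ℓ ∣ N` split (`N⁻ = 1`), `p ∤ D_K`, `(D_K, N) = 1`. Conclusion:
for some parametrisation datum `Dt` of level `N`, orientation `β`, embedding `ι`, some `n ∈ Λ`
(square-free product of Kolyvagin primes, `1 ≤ M(n)`) and Kolyvagin–Heegner datum `d` of conductor
`n`, the class `c_1(n) = d.kolyvaginClass _ 1 ∈ H¹(K, E[p])` is non-zero. Weaker than print (only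
`N⁻ = 1`; parametrisation existential — print: the `(𝒪,p)`-optimal one, (3.20) p. 211); size XL,
no `_holds` expected.
-- TODO(general form): `N⁻` square-free with an even number of prime factors (Shimura curves).
[cite: WZhang2014, Thm. 1.1 (p. 195) = Thm. 9.3 (p. 243); Hypothesis ♠ and Ram (pp. 194–195); standing hypotheses (p. 193); §3.7 (3.20)–(3.21) (p. 211)] -/
def thm11_exists_kolyvaginClass_one_ne_zero : Prop :=
  ∀ (W : WeierstrassCurve ℚ) [W.IsElliptic] [W.IsGloballyMinimal] (p : ℕ) [hp : Fact p.Prime],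
    5 ≤ p → W.HasGoodReductionAtPrime p → ¬ (p : ℤ) ∣ W.frobeniusTrace p →
    W.HasSurjectiveModNGaloisRep p →
    -- Hypothesis ♠ (1) at `N⁻ = 1`: every `ℓ ∥ N` lies in `Ram(ρ̄_{E,p})`
    (∀ (ℓ : ℕ) [Fact ℓ.Prime], W.HasMultiplicativeReductionAtPrime ℓ →
      ¬ p ∣ padicValInt ℓ W.minimalDiscriminantInt) →
    -- Hypothesis ♠ (2) at `N⁻ = 1`: `N` not square-free ⇒ `#Ram ≥ 1` and two primes `ℓ ∥ N`
    (¬ Squarefree (W.conductorNorm ℤ) →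
      (∃ (ℓ : ℕ) (_ : Fact ℓ.Prime), W.HasMultiplicativeReductionAtPrime ℓ ∧
          ¬ p ∣ padicValInt ℓ W.minimalDiscriminantInt) ∧
        ∃ (ℓ₁ ℓ₂ : ℕ) (_ : Fact ℓ₁.Prime) (_ : Fact ℓ₂.Prime), ℓ₁ ≠ ℓ₂ ∧
          W.HasMultiplicativeReductionAtPrime ℓ₁ ∧ W.HasMultiplicativeReductionAtPrime ℓ₂) →
    ∀ (K : Type) [Field K] [NumberField K], IsImaginaryQuadratic K →
      ¬ ((p : ℤ) ∣ NumberField.discr K) →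
      IsCoprime (NumberField.discr K) ((W.conductorNorm ℤ : ℕ) : ℤ) →
      ∀ [NeZero (W.conductorNorm ℤ)], SatisfiesHeegnerHypothesis (W.conductorNorm ℤ) K →
      ∃ (Dt : ModularParametrizationData W (W.conductorNorm ℤ)) (β : ℤ) (ι : K →+* ℂ) (n : ℕ)
        (d : KolyvaginHeegnerData Dt β ι n),
        KolyvaginDescent.KolSupp (Zhang2014.IsKolyvaginPrime (W.conductorNorm ℤ) W K p) n ∧
          (1 : ℕ∞) ≤ Zhang2014.levelIndex W p n ∧ d.kolyvaginClass hp.out 1 ≠ 0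

/-- **W. Zhang 2014, Theorem 1.2 (1.1) — `ord κ^∞ = max{r_p^+(E/K), r_p^-(E/K)} − 1` — composed,
as printed ("Combining Theorem 1.1 with Kolyvagin's theorem [24, Theorem 4]", p. 195; Thm. 11.2,
p. 248), from the named facts `thm11_exists_kolyvaginClass_one_ne_zero` (Thm. 1.1, `N⁻ = 1`) and
`Kolyvagin1991_selmerCorank_of_kolyvaginClass_ne_zero` (Kolyvagin 1991 Thm. 4 / Zhang Thm. 11.2 (i)).**
Under the hypotheses of Thm. 1.1 (`N⁻ = 1`) and Kolyvagin's standing `D_K ≠ −3, −4`: there are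
`Dt, β, ι` and a NON-ZERO class `c_M(n)`, `n ∈ Λ`, `1 ≤ M ≤ M(n)`, whose number of prime factors
`ν(n)` is minimal among all non-zero classes `c_{M'}(n')` of the system (so `ν(n) = ord κ^∞`), and
`max(corank_{ℤ_p} Sel_{p^∞}(E/ℚ), corank_{ℤ_p} Sel_{p^∞}(E^{D_K}/ℚ)) = ν(n) + 1` — the two coranks
being `r_p^±(E/K)` for odd `p` — together with Kolyvagin's parity clause in the form recorded by
the Kolyvagin fact (which eigenspace carries the larger corank is forgotten, as there).
[cite: WZhang2014, Thm. 1.2 (p. 195) and Thm. 11.2 (i) (p. 248)]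
[cite: Kolyvagin1991MathAnn, §2 Thm. 4] -/
theorem thm12_max_selmerCorank_eq_ord_add_one
    (h11 : thm11_exists_kolyvaginClass_one_ne_zero)
    (hKo : Kolyvagin1991_selmerCorank_of_kolyvaginClass_ne_zero)
    (W : WeierstrassCurve ℚ) [W.IsElliptic] [W.IsGloballyMinimal] (p : ℕ) [hp : Fact p.Prime]
    (h5 : 5 ≤ p) (hgood : W.HasGoodReductionAtPrime p) (hord : ¬ (p : ℤ) ∣ W.frobeniusTrace p)
    (hsurj : W.HasSurjectiveModNGaloisRep p)
    (hS1 : ∀ (ℓ : ℕ) [Fact ℓ.Prime], W.HasMultiplicativeReductionAtPrime ℓ →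
      ¬ p ∣ padicValInt ℓ W.minimalDiscriminantInt)
    (hS2 : ¬ Squarefree (W.conductorNorm ℤ) →
      (∃ (ℓ : ℕ) (_ : Fact ℓ.Prime), W.HasMultiplicativeReductionAtPrime ℓ ∧
          ¬ p ∣ padicValInt ℓ W.minimalDiscriminantInt) ∧
        ∃ (ℓ₁ ℓ₂ : ℕ) (_ : Fact ℓ₁.Prime) (_ : Fact ℓ₂.Prime), ℓ₁ ≠ ℓ₂ ∧
          W.HasMultiplicativeReductionAtPrime ℓ₁ ∧ W.HasMultiplicativeReductionAtPrime ℓ₂)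
    (K : Type) [Field K] [NumberField K] (hK : IsImaginaryQuadratic K)
    (hpD : ¬ ((p : ℤ) ∣ NumberField.discr K))
    (hDN : IsCoprime (NumberField.discr K) ((W.conductorNorm ℤ : ℕ) : ℤ))
    (hD3 : NumberField.discr K ≠ -3) (hD4 : NumberField.discr K ≠ -4)
    [NeZero (W.conductorNorm ℤ)] (hHeeg : SatisfiesHeegnerHypothesis (W.conductorNorm ℤ) K) :
    ∃ (Dt : ModularParametrizationData W (W.conductorNorm ℤ)) (β : ℤ) (ι : K →+* ℂ) (n : ℕ)
      (d : KolyvaginHeegnerData Dt β ι n) (M : ℕ),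
      KolyvaginDescent.KolSupp (Zhang2014.IsKolyvaginPrime (W.conductorNorm ℤ) W K p) n ∧
      1 ≤ M ∧ (M : ℕ∞) ≤ Zhang2014.levelIndex W p n ∧ d.kolyvaginClass hp.out M ≠ 0 ∧
      (∀ (n' : ℕ) (d' : KolyvaginHeegnerData Dt β ι n') (M' : ℕ),
          KolyvaginDescent.KolSupp (Zhang2014.IsKolyvaginPrime (W.conductorNorm ℤ) W K p) n' →
          1 ≤ M' → (M' : ℕ∞) ≤ Zhang2014.levelIndex W p n' → d'.kolyvaginClass hp.out M' ≠ 0 →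
          n.primeFactors.card ≤ n'.primeFactors.card) ∧
      max (W.selmerCorank p) ((W.quadraticTwist (NumberField.discr K : ℚ)).selmerCorank p) =
        n.primeFactors.card + 1 ∧
      ((W.selmerCorank p = n.primeFactors.card + 1 ∧
          (W.quadraticTwist (NumberField.discr K : ℚ)).selmerCorank p ≤ n.primeFactors.card ∧
          Even (n.primeFactors.card -
            (W.quadraticTwist (NumberField.discr K : ℚ)).selmerCorank p)) ∨
        ((W.quadraticTwist (NumberField.discr K : ℚ)).selmerCorank p = n.primeFactors.card + 1 ∧
          W.selmerCorank p ≤ n.primeFactors.card ∧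
          Even (n.primeFactors.card - W.selmerCorank p))) := by
  -- Theorem 1.1: a non-zero class `c_1(n₀)`.
  obtain ⟨Dt, β, ι, n₀, d₀, hsupp₀, hM₀, hc₀⟩ :=
    h11 W p h5 hgood hord hsurj hS1 hS2 K hK hpD hDN hHeeg
  -- `ord κ^∞`: the least number of prime factors of a level carrying a non-zero class.
  let P : ℕ → Prop := fun r ↦ ∃ (n : ℕ) (d : KolyvaginHeegnerData Dt β ι n) (M : ℕ),
    KolyvaginDescent.KolSupp (Zhang2014.IsKolyvaginPrime (W.conductorNorm ℤ) W K p) n ∧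
      1 ≤ M ∧ (M : ℕ∞) ≤ Zhang2014.levelIndex W p n ∧ d.kolyvaginClass hp.out M ≠ 0 ∧
      n.primeFactors.card = r
  have hex : ∃ r, P r := ⟨n₀.primeFactors.card, n₀, d₀, 1, hsupp₀, le_rfl, hM₀, hc₀, rfl⟩
  obtain ⟨n, d, M, hsupp, hM1, hMn, hc, hcard⟩ := Nat.find_spec hex
  have hmin : ∀ (n' : ℕ) (d' : KolyvaginHeegnerData Dt β ι n') (M' : ℕ),
      KolyvaginDescent.KolSupp (Zhang2014.IsKolyvaginPrime (W.conductorNorm ℤ) W K p) n' →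
      1 ≤ M' → (M' : ℕ∞) ≤ Zhang2014.levelIndex W p n' → d'.kolyvaginClass hp.out M' ≠ 0 →
      n.primeFactors.card ≤ n'.primeFactors.card := by
    intro n' d' M' hsupp' hM1' hMn' hc'
    rw [hcard]
    exact Nat.find_min' hex ⟨n', d', M', hsupp', hM1', hMn', hc', rfl⟩
  -- `p ∤ N` from good reduction at `p`.
  have hpN : ¬ p ∣ W.conductorNorm ℤ := by
    rw [dvd_conductorNorm_iff_not_hasGoodReductionAtPrime]
    exact fun h ↦ h hgood
  -- Kolyvagin's theorem at the minimal non-zero class.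
  have hstr := hKo W p h5 hsurj K hK hD3 hD4 hpD hpN hHeeg Dt β ι n d M hsupp hM1 hMn hc hmin
  refine ⟨Dt, β, ι, n, d, M, hsupp, hM1, hMn, hc, hmin, ?_, hstr⟩
  rcases hstr with ⟨h1, h2, -⟩ | ⟨h1, h2, -⟩ <;> omega

end Literature.NumberTheory.EllipticCurves.WZhang2014

end
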